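import Summits.Ventures.QEC.Census.BZAssembly
import Summits.Ventures.QEC.Census.CertLogical
import Literature.InformationTheory.QuantumCodes.ParityCheckDuality
import HarnessLib

/-!
# Worked KERNEL example of a Brouwer–Zimmermann (`bz`) distance certificate through the propositional layer:
# Steane `[[7,1,3]]`, `d_Z = 3` (cert/examples/steane7-bz.certA.json, CERT-FORMAT v1 §5.3)

Dress rehearsal for ITEM 10.BZC / S1.BZD / S7.BZI (P1 `[[144,12,12]]`): EVERY hypothesis of
`Census/BZAssembly.lean`'s packaged theorem `dZ_eq_of_bz` is discharged here for a concrete certificate, in the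
shapes the checker will produce — so the interface is known to close in the kernel before the BB144 data arrive.

Certificate (qec-search-1, kernel A, method `bz`, side `Z`): `n = 7`, `H^X = H^Z` rows `{0,2,4,6}, {1,2,5,6},
{3,4,5,6}` (bitmasks `85, 102, 120`); `k_cert`: pivots `[0,1,2]`, right-inverse columns `{0},{1},{3}` (masks
`1, 2, 8`), no dependent rows; logicals `LZ = LX = {0,1,2}` (mask `7`); ONE block: `stab_rows [0,1,2]`, `W_basis
[[0]]` (`j = 1`, `kb = 4`, `G_b = [HZ₀, HZ₁, HZ₂, LZ₀]`); two systematic matrices `G₁ = A₁·G_b` on `T₁ = [6,2,0,3]`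
(rows = masks `82, 52, 51, 42`), `G₂ = A₂·G_b` on `T₂ = [5,4,1,6]` (masks `45, 25, 7, 76`), depths `t = 1, 1`,
relative ranks `4, 3`, bound `(2 − 0) + (2 − 1) = 3 > wmax = 2`; depth-1 enumeration: all 8 rows have weight
`≥ 3 > wmax` (verdict vacuous, `found = []`); cover: the only non-zero label `1 ∈ 𝔽₂¹` is `W₀`; upper witness
`LZ₀` (weight 3) with non-membership witness `LX₀`.

How each hypothesis is met (the pattern 10.BZC generalises): `hdual`/`hpair`/`hdec` = type-10's `CertLogical`
(`mulVec_dual_eq_zero`, `dual_dotProduct_logVec`, `exists_coeffs_of_ker` from `logOK` + two `RankCert.check`s +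
`n = rX + rZ + k`, all `decide`); `hrows` = rows of `H^Z` are members of `G_b` (`rowSpace_eq_span_rows` +
`subset_span`); `hW` = the `W`-combination of the logicals is a member of `G_b`; `hsys`, `hbound` = `decide` on
computable data (`bzBound` is a `Finset` computation); `hG` = `∃ coefficients` over `𝔽₂^kb` by `decide`; `henum` =
the depth-`t` replay (here: every enumerated row has weight `> wmax`, by `decide`); `hcover` = `decide` on labels;
the witness = `mulVec_logVec_eq_zero` + `not_mem_rowSpace_of_witness`. Result: `steane_dZ : (code).dZ = 3`,
KERNEL (no `native_decide`). Not a census row (Steane is control A2, already CERTIFIED by `CertControls.lean`);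
this file certifies the INTERFACE.
-/

namespace Summit.Ventures.QEC.Census

namespace BZExampleSteane

open Matrix Literature.InformationTheory.QuantumCodes Literature.InformationTheory.Coding

/-! ## Certificate data (transcribed from cert/examples/steane7-bz.certA.json, side `Z`) -/

/-- `H^X` rows as bitmasks (supports `{0,2,4,6}, {1,2,5,6}, {3,4,5,6}`). -/
def HX : List ℕ := [85, 102, 120]

/-- `H^Z` rows as bitmasks (Steane: `H^Z = H^X`). -/
def HZ : List ℕ := [85, 102, 120]

/-- The logical `Z` operators `LZ` (one: support `{0,1,2}`). -/
def LZ : List ℕ := [7]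

/-- The logical `X` operators `LX` = the duals of `LZ` (support `{0,1,2}`). -/
def LX : List ℕ := [7]

/-- Rank certificate of `H^X` (`k_cert.X`): rank 3, pivots `[0,1,2]`, right-inverse columns `{0},{1},{3}`. -/
def rcX : RankCert := ⟨3, [0, 1, 2], [1, 2, 8], []⟩

/-- Rank certificate of `H^Z` (`k_cert.Z`). -/
def rcZ : RankCert := ⟨3, [0, 1, 2], [1, 2, 8], []⟩

/-- The block code generators `G_b = [HZ₀, HZ₁, HZ₂, LZ₀]` (`stab_rows ++ W`-combinations), as bitmasks. -/
def gbMask : Fin 4 → ℕ := ![85, 102, 120, 7]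

/-- The two systematic matrices `G₁ = A₁·G_b`, `G₂ = A₂·G_b` of the block (rows as bitmasks). -/
def gMask : Fin 2 → Fin 4 → ℕ := ![![82, 52, 51, 42], ![45, 25, 7, 76]]

/-- Their information sets (ordered pivot columns) `T₁ = [6,2,0,3]`, `T₂ = [5,4,1,6]`. -/
def T : Fin 1 → Fin 2 → Fin 4 → Fin 7 := ![![![6, 2, 0, 3], ![5, 4, 1, 6]]]

/-- Enumeration depths `t₁ = t₂ = 1`. -/
def t : Fin 1 → Fin 2 → ℕ := fun _ _ => 1

/-- `G_b` as vectors (one block). -/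
def Gb : Fin 1 → Fin 4 → Fin 7 → ZMod 2 := fun _ j => ofBits 7 (gbMask j)

/-- `G₁, G₂` as vectors. -/
def G : Fin 1 → Fin 2 → Fin 4 → Fin 7 → ZMod 2 := fun _ i j => ofBits 7 (gMask i j)

/-- The block's label vectors `W_basis = [[0]]`: the single label `e₀ = 1 ∈ 𝔽₂¹`. -/
def W : Fin 1 → Fin 1 → Fin LZ.length → ZMod 2 := fun _ _ _ => 1

/-- The logicals as vectors (type-10's `logVec`). -/
abbrev L : Fin LZ.length → Fin 7 → ZMod 2 := logVec 7 LZ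

/-- The duals as a matrix (row `j` = `LX_j`). -/
def Ld : Matrix (Fin LZ.length) (Fin 7) (ZMod 2) := fun j => ofBits 7 (LX.getD j 0)

/-! ## The Boolean checks (all `decide`) -/

/-- O2: the commutation check passes. -/
theorem commOK_steane : commOK 7 HX HZ = true := by decide
/-- O3: the rank certificate of `H^X` passes (`rank H^X = 3`). -/
theorem rcX_check : rcX.check 7 HX = true := by decide
/-- O3: the rank certificate of `H^Z` passes (`rank H^Z = 3`). -/
theorem rcZ_check : rcZ.check 7 HZ = true := by decide
/-- O4: the pairing check of the logical bases passes. -/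
theorem logOK_steane : logOK 7 HX HZ LZ LX = true := by decide

/-- The CSS code of the certificate (type-02's `CSSCode` on the row-list matrices). -/
abbrev code : CSSCode (Fin HX.length) (Fin HZ.length) (Fin 7) :=
  CSSCode.ofMatrices (rowMatrix 7 HX) (rowMatrix 7 HZ) (comm_of_commOK commOK_steane)

/-! ## Discharging the hypotheses of `dZ_eq_of_bz` -/

/-- `hdual`: the duals `LX_j` lie in `ker H^Z` (from `logOK`). -/
theorem hdual : ∀ j, code.HZ *ᵥ Ld j = 0 := fun j => mulVec_dual_eq_zero logOK_steane j

/-- `hpair`: `LX_j ⬝ LZ_i = [i = j]` (from `logOK`). -/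
theorem hpair : ∀ i j, Ld j ⬝ᵥ L i = if i = j then 1 else 0 :=
  fun i j => dual_dotProduct_logVec logOK_steane i j

/-- `hdec`: L1, every `z ∈ ker H^X` is a logical combination modulo `rs H^Z` (type-10's
`exists_coeffs_of_ker` from the two rank certificates, the pairing and `n = rX + rZ + k`). -/
theorem hdec : ∀ z : Fin 7 → ZMod 2, code.HX *ᵥ z = 0 →
    ∃ a : Fin LZ.length → ZMod 2, z - ∑ i, a i • L i ∈ code.rowSpZ :=
  fun _ hz => exists_coeffs_of_ker (comm_of_commOK commOK_steane) rcX_check rcZ_check logOK_steane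
    (by decide) hz

/-- Every row of `H^Z` is one of the block generators. -/
theorem row_mem_range_Gb : ∀ i : Fin HZ.length, rowMatrix 7 HZ i ∈ Set.range (Gb 0) := by
  decide

/-- `hrows`: `rs H^Z` lies in the block code (its rows are block generators). -/
theorem hrows : ∀ b, code.rowSpZ ≤ Submodule.span (ZMod 2) (Set.range (Gb b)) := by
  intro b
  obtain rfl : b = 0 := Subsingleton.elim _ _
  change rowSpace (rowMatrix 7 HZ) ≤ _
  rw [rowSpace_eq_span_rows]
  exact Submodule.span_le.2 fun _ ⟨i, hi⟩ => hi ▸ Submodule.subset_span (row_mem_range_Gb i)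

/-- The `W`-combination of the logicals is the last block generator. -/
theorem sum_W_smul_eq : ∀ b l, ∑ i, W b l i • L i = Gb b 3 := by decide

/-- `hW`: the block's `W`-combination of the logicals lies in the block code. -/
theorem hW : ∀ b l, ∑ i, W b l i • L i ∈ Submodule.span (ZMod 2) (Set.range (Gb b)) :=
  fun b l => sum_W_smul_eq b l ▸ Submodule.subset_span ⟨3, rfl⟩

/-- `hsys`: C3, both matrices are systematic on their information sets. -/
theorem hsys : ∀ b i j j', G b i j (T b i j') = if j = j' then 1 else 0 := by decide

/-- Each `G_i` row is an explicit combination of `G_b` rows (the shipped `A_i`, found here by `decide`). -/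
theorem exists_coeffs_G : ∀ b i j, ∃ c : Fin 4 → ZMod 2, ∑ r, c r • Gb b r = G b i j := by decide

/-- `hG`: the rows of `G₁, G₂` lie in the block code. -/
theorem hG : ∀ b i j, G b i j ∈ Submodule.span (ZMod 2) (Set.range (Gb b)) :=
  fun b i j => (Submodule.mem_span_range_iff_exists_fun (ZMod 2)).2 (exists_coeffs_G b i j)

/-- The depth-1 replay: every enumerated codeword has weight `> wmax = 2` (so the verdict is vacuous). -/
theorem replay : ∀ b i (a : Fin 4 → ZMod 2), 1 ≤ hammingNorm a → hammingNorm a ≤ t b i →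
    ¬ hammingNorm (∑ j, a j • G b i j) ≤ 2 := by
  decide

/-- `henum`: C4, the enumeration verdict (vacuous here: no enumerated codeword has weight `≤ wmax`). -/
theorem henum : ∀ b i (a : Fin 4 → ZMod 2), 1 ≤ hammingNorm a → hammingNorm a ≤ t b i →
    hammingNorm (∑ j, a j • G b i j) ≤ 2 → (∑ j, a j • G b i j) ∈ code.rowSpZ :=
  fun b i a h1 ht hw => absurd hw (replay b i a h1 ht)

/-- `hbound`: C3, the Brouwer–Zimmermann bound `3` exceeds `wmax = 2` (relative ranks `4, 3`). -/
theorem hbound : ∀ b, 2 < bzBound (T b) (t b) := by decide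

/-- The only non-zero label of `𝔽₂¹` is `W₀ = 1`. -/
theorem label_eq : ∀ lam : Fin LZ.length → ZMod 2, lam ≠ 0 → lam = W 0 0 := by decide

/-- `hcover`: C5, every non-zero label lies in the span of the block's `W`. -/
theorem hcover : ∀ lam : Fin LZ.length → ZMod 2, lam ≠ 0 →
    ∃ b, lam ∈ Submodule.span (ZMod 2) (Set.range (W b)) :=
  fun lam h => ⟨0, label_eq lam h ▸ Submodule.subset_span ⟨0, rfl⟩⟩

/-! ## The upper witness and the theorem -/

/-- O5: the upper witness `LZ₀` has zero `H^X`-syndrome. -/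
theorem hv : code.HX *ᵥ L ⟨0, by decide⟩ = 0 := mulVec_logVec_eq_zero logOK_steane _

/-- O5: the upper witness is not a stabilizer (non-membership witness `LX₀`, odd overlap). -/
theorem hv' : L ⟨0, by decide⟩ ∉ code.rowSpZ :=
  not_mem_rowSpace_of_witness (Ld ⟨0, by decide⟩) (hdual _) (by rw [hpair]; decide)

/-- O5: the upper witness has weight `3 = wmax + 1`. -/
theorem hwt : hammingNorm (L ⟨0, by decide⟩) = 2 + 1 := by decide

/-- **Steane `[[7,1,3]]`: `d_Z = 3` by a Brouwer–Zimmermann certificate, KERNEL**, through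
`Census/BZAssembly.lean`'s `dZ_eq_of_bz` with every hypothesis discharged as 10.BZC will. -/
theorem steane_dZ : code.dZ = 3 :=
  dZ_eq_of_bz code hdual hpair hdec hrows hW hsys hG henum hbound hcover hv hv' hwt

end BZExampleSteane

end Summit.Ventures.QEC.Census
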